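import Mathlib
import Summits.NavierStokesRegularity.NavierStokesRegularity.Theorems.EulerZoomLiouvillePowerGaugeEulerLiouvilleCondenserCrossings
import Summits.NavierStokesRegularity.NavierStokesRegularity.Theorems.EulerZoomLiouvillePowerGaugeEulerLiouvilleNeedleThinCoreMember
import Summits.NavierStokesRegularity.NavierStokesRegularity.Theorems.EulerZoomLiouvillePowerGaugeEulerLiouvilleNeedleRaceMember

/-!
# THE CONDENSER AT MEMBER LEVEL: for an exactly self-similar `C²` member of the crux class, leaving `B(0,2R)` backwards
# along a cut-off copy of the profile costs a gradient `exp(c·R^{2+ρ})` (ROUND-42 THEOREM B in the vocabulary of THE ONE STATEMENT)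

Width piece for crux `EulerZoomLiouville.PowerGaugeEulerLiouville` (stmt-NavierStokesRegularity-19832), by name under
LEAD 19832 (ns-typeII-p2 g12); seat ns-ezl-w2 g3, `--supports stmt-NavierStokesRegularity-19832 --as helper`.

* `setIntegral_sq_le_of_lintegral` — bookkeeping: an `ℝ≥0∞` bound `∫⁻_s ‖f‖ₑ² ≤ ofReal B` gives the real bound `∫_s ‖f‖² ≤ B`.
* **`exp_le_gradient_or_small_of_exit_selfSimilarC2`** — crux hypotheses VERBATIM (`InClass`: suitable weak solution on the
  slab, weak gradient, the three power gauges with constant `c`), exactly self-similar velocity/pressure with a `C²` profile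
  `V` (`γ = 1/(2+ρ)`), a cut-off copy `Vc ∈ C¹` (`‖DVc‖ ≤ K`, `Vc = V` on `ball 0 R_big`, `3R ≤ R_big`, `R ≥ 1`), a gradient
  bound `‖DV‖ ≤ G_m` on `B(0,3R)`; if ONE backward orbit of the cut-off similarity flow goes from `‖y‖ < R` to `‖Ψ_L y‖ ≥ 2R`
  and there is room, then with the CLASS BUDGETS `X = (c+1)(3R)^{1−2ρ}`, `Y = ((1−ρ)/(2+ρ)·c + 1)(3R)^{1−ρ}`:
  `(γR/(4(R/4)))·exp(π(γR)²/(32(4Y/R))) ≤ √2·G_m  ∨  π(γR)²/(32(4Y/R)) ≤ log 2`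
  — i.e. `sup_{B(0,3R)}‖DV‖ ≳ γ·exp(c'·γ²R^{2+ρ}/c)` for `R ≥ R₀(c, ρ)`: nsreg-p2 g33's «the clock exponent 2+ρ is the
  E-gauge's condenser exponent», now for the objects of `Sig.stub_selfSimilarC2Needle`.
  [profile budgets: `NeedleThinCore.selfSimilar_needle_inputs` + `NeedleRace.lintegral_fderiv_sq_closedBall_le`; then
  `Condenser.exp_le_gradient_or_small_of_exit` for the cut-off copy, which agrees with `V` on `B(0,3R)`.]

HONEST FRAMING: a PORTRAIT statement about HYPOTHETICAL self-similar members (blow-up needles) of the crux class; it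
discharges no binder of THE ONE STATEMENT and proves nothing about the crux E `PowerGaugeEulerLiouville` (19832 OPEN), any
door Target, or Navier–Stokes regularity; MODEL lattice only (19832 is a crux CLASS — E/NS strata — not NS regularity).
[cite: ConstantinIgnatovaVicol2026Putative, §3.4.1; folklore (length–area method)]
-/

noncomputable section

open Set Filter Topology Metric Function MeasureTheory Real
open scoped RealInnerProductSpace NNReal ENNReal

set_option linter.dupNamespace false

namespace Summit.NavierStokesRegularity.NavierStokesRegularity.Theorems.PowerGaugeEulerLiouville.Condenser

open Literature.Analysis Literature.Analysis.FluidPDE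
open Summit.NavierStokesRegularity.NavierStokesRegularity.Theorems.PowerGaugeEulerLiouville

/-- Bookkeeping: for continuous `f`, `∫⁻_s ‖f‖ₑ² ≤ ofReal B` with `0 ≤ B` gives `∫_s ‖f‖² ≤ B`. [folklore] -/
theorem setIntegral_sq_le_of_lintegral {F : Type*} [NormedAddCommGroup F] {f : EuclideanSpace ℝ (Fin 3) → F}
    (hf : Continuous f) {s : Set (EuclideanSpace ℝ (Fin 3))} {B : ℝ} (hB : 0 ≤ B)
    (h : ∫⁻ x in s, ‖f x‖ₑ ^ 2 ≤ ENNReal.ofReal B) : ∫ x in s, ‖f x‖ ^ 2 ≤ B := by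
  rw [integral_eq_lintegral_of_nonneg_ae (Filter.Eventually.of_forall fun x => sq_nonneg _)
    (hf.norm.pow 2).aestronglyMeasurable]
  refine ENNReal.toReal_le_of_le_ofReal hB (le_trans (le_of_eq ?_) h)
  refine lintegral_congr fun x => ?_
  rw [← ofReal_norm, ← ENNReal.ofReal_pow (norm_nonneg _)]

/-- **ROUND-42 THEOREM B AT MEMBER LEVEL.**  See the module docstring.
[cite: ConstantinIgnatovaVicol2026Putative, §3.4.1; folklore (length–area method)] -/
theorem exp_le_gradient_or_small_of_exit_selfSimilarC2 {ρ : ℝ} (hρ : 0 < ρ) (hρ1 : ρ ≤ 1 / 2)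
    {u : ℝ → EuclideanSpace ℝ (Fin 3) → EuclideanSpace ℝ (Fin 3)} {p : ℝ → EuclideanSpace ℝ (Fin 3) → ℝ}
    {H : ℝ → EuclideanSpace ℝ (Fin 3) → EuclideanSpace ℝ (Fin 3) →L[ℝ] EuclideanSpace ℝ (Fin 3)} {c : ℝ≥0}
    (hsw : IsSuitableWeakSolutionOn (slab (EuclideanSpace ℝ (Fin 3)) (Iio 0) isOpen_Iio) 0 0 u p)
    (hH : HasWeakSpatialGradientOn (slab (EuclideanSpace ℝ (Fin 3)) (Iio 0) isOpen_Iio) u H)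
    (hgauge : ∀ a : ℝ, 0 < a →
      ENNReal.ofReal (a ^ (2 * ρ)) * cknA a (0 : ℝ × EuclideanSpace ℝ (Fin 3)) u +
          ENNReal.ofReal (a ^ ρ) * cknE a (0 : ℝ × EuclideanSpace ℝ (Fin 3)) H +
        ENNReal.ofReal (a ^ (2 * ρ)) * cknD a (0 : ℝ × EuclideanSpace ℝ (Fin 3)) p ≤ (c : ℝ≥0∞))
    {V : EuclideanSpace ℝ (Fin 3) → EuclideanSpace ℝ (Fin 3)} {P : EuclideanSpace ℝ (Fin 3) → ℝ}
    (hu : ∀ τ : ℝ, τ < 0 → u τ = selfSimilarCollapse (1 / (2 + ρ)) 0 V τ)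
    (hp : ∀ τ : ℝ, τ < 0 → p τ = selfSimilarCollapsePressure (1 / (2 + ρ)) 0 P τ)
    (hV : ContDiff ℝ 2 V)
    {Vc : EuclideanSpace ℝ (Fin 3) → EuclideanSpace ℝ (Fin 3)} (hVc : ContDiff ℝ 1 Vc) {K : ℝ}
    (hK : ∀ y, ‖fderiv ℝ Vc y‖ ≤ K) {R Rbig : ℝ} (hR : 1 ≤ R) (h3R : 3 * R ≤ Rbig)
    (hVU : ∀ w ∈ ball (0 : EuclideanSpace ℝ (Fin 3)) Rbig, Vc w = V w)
    {Gm : ℝ} (hGm : ∀ z ∈ ball (0 : EuclideanSpace ℝ (Fin 3)) (3 * R), ‖fderiv ℝ V z‖ ≤ Gm)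
    {y : EuclideanSpace ℝ (Fin 3)} (hy : ‖y‖ < R) {L : ℝ} (hL : 0 ≤ L)
    (hexit : 2 * R ≤ ‖ODE.evolutionMap (fun _ : ℝ => selfSimilarTransport (1 / (2 + ρ)) 0 Vc) 0 (-L) y‖)
    (hroom : 8 * (4 * (((c : ℝ) + 1) * (3 * R) ^ (1 - 2 * ρ)) / R) / (Real.pi * (1 / (2 + ρ) * R) ^ 2) ≤
      3 / 4 * (R / 4) ^ 2) :
    1 / (2 + ρ) * R / (4 * (R / 4)) *
          Real.exp (Real.pi * (1 / (2 + ρ) * R) ^ 2 /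
            (32 * (4 * (((1 - ρ) / (2 + ρ) * (c : ℝ) + 1) * (3 * R) ^ (1 - ρ)) / R))) ≤ Real.sqrt 2 * Gm ∨
      Real.pi * (1 / (2 + ρ) * R) ^ 2 /
          (32 * (4 * (((1 - ρ) / (2 + ρ) * (c : ℝ) + 1) * (3 * R) ^ (1 - ρ)) / R)) ≤ Real.log 2 := by
  have hρ1' : ρ < 1 := by linarith
  have h2ρ : (0 : ℝ) < 2 + ρ := by linarith
  have hγ : (0 : ℝ) < 1 / (2 + ρ) := one_div_pos.2 h2ρ
  have hR0 : 0 < R := by linarith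
  have h3R1 : (1 : ℝ) ≤ 3 * R := by linarith
  have h3R0 : (0 : ℝ) < 3 * R := by linarith
  -- the class budgets of the profile
  obtain ⟨hA', hE'⟩ :=
    NeedleThinCore.selfSimilar_needle_inputs hρ hρ1' hsw hH hgauge hu hp (hV.of_le one_le_two)
  have hE0 : 0 ≤ (1 - ρ) / (2 + ρ) * (c : ℝ) := by
    have : 0 ≤ 1 - ρ := by linarith
    positivity
  set X : ℝ := ((c : ℝ) + 1) * (3 * R) ^ (1 - 2 * ρ) with hX
  set Y : ℝ := ((1 - ρ) / (2 + ρ) * (c : ℝ) + 1) * (3 * R) ^ (1 - ρ) with hY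
  have hXpos : 0 < X := by positivity
  have hYpos : 0 < Y := by positivity
  have hAV : ∫ x in ball (0 : EuclideanSpace ℝ (Fin 3)) (3 * R), ‖V x‖ ^ 2 ≤ X := by
    refine setIntegral_sq_le_of_lintegral hV.continuous hXpos.le ((hA' (3 * R) h3R0).trans ?_)
    rw [hX, ← ENNReal.ofReal_coe_nnreal, ← ENNReal.ofReal_mul (NNReal.coe_nonneg c)]
    exact ENNReal.ofReal_le_ofReal (by nlinarith [Real.rpow_nonneg h3R0.le (1 - 2 * ρ), NNReal.coe_nonneg c])
  have hEV : ∫ x in ball (0 : EuclideanSpace ℝ (Fin 3)) (3 * R), ‖fderiv ℝ V x‖ ^ 2 ≤ Y := by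
    have h1 := NeedleRace.lintegral_fderiv_sq_closedBall_le hρ1' hE0 hE' h3R1
    have h2 : ∫⁻ z in ball (0 : EuclideanSpace ℝ (Fin 3)) (3 * R), ‖fderiv ℝ V z‖ₑ ^ 2 ≤
        ENNReal.ofReal ((1 - ρ) / (2 + ρ) * (c : ℝ) * (3 * R) ^ (1 - ρ)) :=
      (lintegral_mono_set ball_subset_closedBall).trans h1
    refine setIntegral_sq_le_of_lintegral (hV.continuous_fderiv (by norm_num)) hYpos.le (h2.trans ?_)
    exact ENNReal.ofReal_le_ofReal (by rw [hY]; nlinarith [Real.rpow_nonneg h3R0.le (1 - ρ)])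
  -- transfer to the cut-off copy on `B(0,3R) ⊆ ball 0 R_big`
  have hball : ball (0 : EuclideanSpace ℝ (Fin 3)) (3 * R) ⊆ ball 0 Rbig := ball_subset_ball h3R
  have hfd : ∀ z ∈ ball (0 : EuclideanSpace ℝ (Fin 3)) (3 * R), fderiv ℝ Vc z = fderiv ℝ V z := fun z hz =>
    Filter.EventuallyEq.fderiv_eq (Filter.eventually_of_mem (isOpen_ball.mem_nhds (hball hz)) hVU)
  have hAc : ∫ x in ball (0 : EuclideanSpace ℝ (Fin 3)) (3 * R), ‖Vc x‖ ^ 2 ≤ X := by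
    rw [setIntegral_congr_fun measurableSet_ball (fun x hx => by rw [hVU x (hball hx)])]
    exact hAV
  have hEc : ∫ x in ball (0 : EuclideanSpace ℝ (Fin 3)) (3 * R), ‖fderiv ℝ Vc x‖ ^ 2 ≤ Y := by
    rw [setIntegral_congr_fun measurableSet_ball (fun x hx => by rw [hfd x hx])]
    exact hEV
  have hGmc : ∀ z ∈ ball (0 : EuclideanSpace ℝ (Fin 3)) (3 * R), ‖fderiv ℝ Vc z‖ ≤ Gm := fun z hz => by
    rw [hfd z hz]; exact hGm z hz
  exact exp_le_gradient_or_small_of_exit hVc hK hγ hR0 hXpos hYpos hAc hEc hGmc hy hL hexit hroom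

end Summit.NavierStokesRegularity.NavierStokesRegularity.Theorems.PowerGaugeEulerLiouville.Condenser

end
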